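import Summits.HodgeConjecture.HodgeConjecture.Theorems.K2E3OrbitClosureFlagBasis
import Mathlib.LinearAlgebra.Matrix.Basis
import Mathlib.LinearAlgebra.Matrix.GeneralLinearGroup.Defs
import Mathlib.Topology.Algebra.Ring.Basic
import Mathlib.Topology.Algebra.GroupWithZero
import Mathlib.Topology.Instances.Matrix
import Mathlib.Topology.Algebra.Valued.WithZeroMulInt
import Mathlib.NumberTheory.NumberField.Completion.FinitePlace
import HarnessLib

/-!
# K2 ∕ E3 «EllipticInputs», unit U12 — helper file for socket #10 `sig_K2E3OrbitClosureContainsSemisimple`: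
# the contracting cocharacter of a flag basis and the `GL_N` model «the closure of a conjugacy class of `GL_N(E_w)` contains a
# semisimple element»

Cell `hodgecm-mathlib` (Track B «K2-LIT»), item h413 = `stmt-HodgeConjecture-24833`; author K2E3-p10 (g0).  PROOF lane (theorems
only, no `sorry`).  This is the split-place half (`U(H)(L⁺_v) ≅ GL_N(L_w)` by ★ `UnitaryGroup.localSplitEquiv`) of the printed
statement [HarishChandra1999, §21 p. 87] «Let 𝒪 be a G-orbit in G. Then the closure of 𝒪 contains a semisimple element γ», and the
limit machinery shared with the hermitian half (`K2E3OrbitClosureHermitianGradedBasis`).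

Given a flag basis `(b, e, s)` of `g` (★ `K2E3OrbitClosureFlagBasis.exists_flag_basis`), the cocharacter `D(u) : b_l ↦ u^{e_l} b_l`
(`exists_GL_basis_zpow_smul`) satisfies `D(u) g D(u)⁻¹ → S` (`toLin' S = s`) as `u → 0` through units (`tendsto_conj_of_flag_basis`: in the
basis `b` the entries are `u^{e_k − e_l} g_{kl}` with `e_k ≥ e_l`), in the unit-group topology of `GL_N(K)` (= the matrix topology over a
topological field, `isEmbedding_GL_val`).  Over a completion `K = E_w` a null sequence of units exists (`exists_seq_ne_zero_tendsto_zero`),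
whence `exists_mem_closure_conj_isSemisimple_GL`.

References: [HarishChandra1999] Harish-Chandra (notes by DeBacker–Sally), *Admissible invariant distributions on reductive p-adic groups*,
AMS ULS 16 (1999), §21 p. 87; the `GL_N` argument is folklore.
-/

set_option autoImplicit false
set_option linter.dupNamespace false

namespace Summit.HodgeConjecture.HodgeConjecture.Cruxes.H413.K2E3OrbitClosureFlagLimit

open Module Module.End Filter Topology K2E3OrbitClosureFlagBasis
open scoped Matrix

/-! ## §1 The contracting cocharacter and the limit of conjugates -/

section Limit

variable {K : Type*} [Field K] {n : Type*} [Fintype n] [DecidableEq n] {ι : Type*} [Fintype ι] [DecidableEq ι]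

/-- `GL_n(K) ↪ M_n(K)` is a topological embedding over a topological field with continuous inversion: the unit-group topology is
the matrix topology (`A ↦ A⁻¹ = (det A)⁻¹ • adj A` is continuous on the invertible locus; Mathlib `Units.isEmbedding_val_mk'`). [folklore] -/
theorem isEmbedding_GL_val [TopologicalSpace K] [IsTopologicalRing K] [ContinuousInv₀ K] [T1Space K] :
    IsEmbedding (Units.val : GL n K → Matrix n n K) := by
  refine Units.isEmbedding_val_mk' (f := fun A : Matrix n n K => A⁻¹) ?_ fun u => (Matrix.coe_units_inv u).symm
  intro A hA
  have hdet : A.det ≠ 0 := ((Matrix.isUnit_iff_isUnit_det A).mp hA).ne_zero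
  have h1 : ContinuousAt (fun B : Matrix n n K => B.det⁻¹ • B.adjugate) A :=
    (continuous_id.matrix_det.continuousAt.inv₀ hdet).smul continuous_id.matrix_adjugate.continuousAt
  refine (h1.congr ?_).continuousWithinAt
  filter_upwards [(continuous_id.matrix_det.continuousAt (x := A)).eventually_ne hdet] with B _
  rw [Matrix.inv_def, Ring.inverse_eq_inv]

/-- **The cocharacter of a levelled basis**: for `u ≠ 0` there is `D ∈ GL_n(K)` acting by `b_l ↦ u^{e_l} b_l` (and `D⁻¹` by
`b_l ↦ u^{-e_l} b_l`). [folklore] -/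
theorem exists_GL_basis_zpow_smul (b : Basis ι K (n → K)) (e : ι → ℤ) {u : K} (hu : u ≠ 0) :
    ∃ D : GL n K, (∀ l, Matrix.toLin' (D : Matrix n n K) (b l) = u ^ e l • b l) ∧
      ∀ l, Matrix.toLin' ((D⁻¹ : GL n K) : Matrix n n K) (b l) = (u ^ e l)⁻¹ • b l := by
  let d : (n → K) →ₗ[K] (n → K) := b.constr K fun l => u ^ e l • b l
  let d' : (n → K) →ₗ[K] (n → K) := b.constr K fun l => (u ^ e l)⁻¹ • b l
  have hune : ∀ l, u ^ e l ≠ 0 := fun l => zpow_ne_zero _ hu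
  have hdd' : d ∘ₗ d' = LinearMap.id := b.ext fun l => by
    simp [d, d', smul_smul, inv_mul_cancel₀ (hune l)]
  have hd'd : d' ∘ₗ d = LinearMap.id := b.ext fun l => by
    simp [d, d', smul_smul, mul_inv_cancel₀ (hune l)]
  refine ⟨⟨LinearMap.toMatrix' d, LinearMap.toMatrix' d',
    by rw [← LinearMap.toMatrix'_comp, hdd', LinearMap.toMatrix'_id],
    by rw [← LinearMap.toMatrix'_comp, hd'd, LinearMap.toMatrix'_id]⟩, fun l => ?_, fun l => ?_⟩
  · change Matrix.toLin' (LinearMap.toMatrix' d) (b l) = _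
    rw [Matrix.toLin'_toMatrix']
    exact b.constr_basis K _ l
  · change Matrix.toLin' (LinearMap.toMatrix' d') (b l) = _
    rw [Matrix.toLin'_toMatrix']
    exact b.constr_basis K _ l

omit [Fintype n] [DecidableEq n] [Fintype ι] [DecidableEq ι] in
/-- Coordinates of a basis-diagonal map: if `d b_l = c_l • b_l` then `(d v)_k = c_k (v)_k`. [folklore] -/
theorem repr_apply_of_basis_smul {V : Type*} [AddCommGroup V] [Module K V] (b : Basis ι K V) (c : ι → K)
    (d : Module.End K V) (hd : ∀ l, d (b l) = c l • b l) (v : V) (k : ι) : b.repr (d v) k = c k * b.repr v k := by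
  have key : (Finsupp.lapply k) ∘ₗ (b.repr : V →ₗ[K] ι →₀ K) ∘ₗ d = c k • ((Finsupp.lapply k) ∘ₗ (b.repr : V →ₗ[K] ι →₀ K)) := by
    refine b.ext fun l => ?_
    by_cases hkl : l = k
    · subst hkl; simp [hd]
    · simp [hd, hkl]
  simpa using LinearMap.congr_fun key v

/-- **The limit of conjugates along the cocharacter.**  Let `g ∈ GL_n(K)` be block upper-triangular for a levelled basis `(b, e)` with
semisimple level-diagonal part `s` (`exists_flag_basis` shape), `t_m → 0` a null sequence of units and `D_m` the cocharacter at `t_m`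
(`D_m b_l = t_m^{e_l} b_l`).  Then `D_m g D_m⁻¹ → S` in `GL_n(K)` for an `S` with matrix `toMatrix' s` (so `toLin' S = s` is semisimple): in the
basis `b` the `(k,l)` entry of `D_m g D_m⁻¹` is `t_m^{e_k − e_l} g_{kl}` with `e_k ≥ e_l`, which tends to the level-diagonal part; `s` is
invertible because `det` is continuous and constant (`= det g`) along the sequence. [cite: HarishChandra1999, §21 p. 87] -/
theorem tendsto_conj_of_flag_basis [TopologicalSpace K] [IsTopologicalRing K] [ContinuousInv₀ K] [T2Space K]
    (g : GL n K) (b : Basis ι K (n → K)) (e : ι → ℤ) (s : Module.End K (n → K))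
    (hflag : ∀ k l, e k < e l → b.repr (Matrix.toLin' (g : Matrix n n K) (b l)) k = 0)
    (hdiag : ∀ k l, b.repr (s (b l)) k = if e k = e l then b.repr (Matrix.toLin' (g : Matrix n n K) (b l)) k else 0)
    (hss : s.IsSemisimple)
    (t : ℕ → K) (ht0 : ∀ m, t m ≠ 0) (ht : Tendsto t atTop (𝓝 0))
    (D : ℕ → GL n K) (hD : ∀ m l, Matrix.toLin' (D m : Matrix n n K) (b l) = t m ^ e l • b l)
    (hD' : ∀ m l, Matrix.toLin' ((D m)⁻¹ : GL n K) (b l) = (t m ^ e l)⁻¹ • b l) :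
    ∃ S : GL n K, (S : Matrix n n K) = LinearMap.toMatrix' s ∧ Module.End.IsSemisimple (Matrix.toLin' (S : Matrix n n K)) ∧
      Tendsto (fun m => D m * g * (D m)⁻¹) atTop (𝓝 S) := by
  -- matrices in the basis `b`
  set G : Module.End K (n → K) := Matrix.toLin' (g : Matrix n n K) with hG
  let Gm : Matrix ι ι K := LinearMap.toMatrix b b G
  let Φ : K → Matrix ι ι K := fun x => Matrix.of fun k l => if e l ≤ e k then x ^ (e k - e l).toNat * Gm k l else 0
  have hΦc : Continuous Φ := by
    refine continuous_matrix fun k l => ?_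
    by_cases hkl : e l ≤ e k
    · have hfun : (fun x => Φ x k l) = fun x => x ^ (e k - e l).toNat * Gm k l := by
        funext x; simp [Φ, hkl]
      rw [hfun]
      exact (continuous_id.pow _).mul continuous_const
    · have hfun : (fun x => Φ x k l) = fun _ => 0 := by
        funext x; simp [Φ, hkl]
      rw [hfun]
      exact continuous_const
  have hΦ0 : Φ 0 = LinearMap.toMatrix b b s := by
    ext k l
    simp only [Φ, Matrix.of_apply, LinearMap.toMatrix_apply, hdiag, Gm, hG]
    by_cases hkl : e k = e l
    · simp [hkl]
    · by_cases hle : e l ≤ e k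
      · have hpos : (e k - e l).toNat ≠ 0 := by
          intro h; rw [Int.toNat_eq_zero] at h; omega
        simp [hle, hkl, zero_pow hpos]
      · simp [hle, hkl]
  -- conjugate in the basis `b`
  have hconj : ∀ m, LinearMap.toMatrix b b
      (Matrix.toLin' (D m : Matrix n n K) ∘ₗ G ∘ₗ Matrix.toLin' ((D m)⁻¹ : GL n K)) = Φ (t m) := by
    intro m
    ext k l
    rw [LinearMap.toMatrix_apply, LinearMap.comp_apply, LinearMap.comp_apply, hD',
      repr_apply_of_basis_smul b (fun l => t m ^ e l) _ (hD m) _ k, map_smul, map_smul, Finsupp.smul_apply, smul_eq_mul]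
    change t m ^ e k * ((t m ^ e l)⁻¹ * b.repr (G (b l)) k) = Φ (t m) k l
    simp only [Φ, Matrix.of_apply, Gm, LinearMap.toMatrix_apply]
    by_cases hle : e l ≤ e k
    · rw [if_pos hle, ← mul_assoc, ← zpow_neg, ← zpow_add₀ (ht0 m), ← zpow_natCast,
        Int.toNat_of_nonneg (sub_nonneg.2 hle), sub_eq_add_neg]
    · rw [if_neg hle, hflag k l (not_le.1 hle), mul_zero, mul_zero]
  -- back to standard coordinates
  have hstd : ∀ X : Module.End K (n → K), LinearMap.toMatrix' X =
      (Pi.basisFun K n).toMatrix b * LinearMap.toMatrix b b X * b.toMatrix (Pi.basisFun K n) := by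
    intro X
    rw [basis_toMatrix_mul_linearMap_toMatrix_mul_basis_toMatrix, LinearMap.toMatrix_eq_toMatrix']
  have hval : ∀ m, ((D m * g * (D m)⁻¹ : GL n K) : Matrix n n K) =
      (Pi.basisFun K n).toMatrix b * Φ (t m) * b.toMatrix (Pi.basisFun K n) := by
    intro m
    rw [← hconj, ← hstd, LinearMap.toMatrix'_comp, LinearMap.toMatrix'_comp, LinearMap.toMatrix'_toLin', hG,
      LinearMap.toMatrix'_toLin', LinearMap.toMatrix'_toLin', Units.val_mul, Units.val_mul, Matrix.mul_assoc]
  have hsval : LinearMap.toMatrix' s = (Pi.basisFun K n).toMatrix b * Φ 0 * b.toMatrix (Pi.basisFun K n) := by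
    rw [hΦ0, ← hstd]
  -- convergence of the matrices
  have hmat : Tendsto (fun m => ((D m * g * (D m)⁻¹ : GL n K) : Matrix n n K)) atTop (𝓝 (LinearMap.toMatrix' s)) := by
    simp only [hval, hsval]
    have h1 : Tendsto (fun m => Φ (t m)) atTop (𝓝 (Φ 0)) := (hΦc.tendsto 0).comp ht
    have hc : Continuous fun X : Matrix ι ι K => (Pi.basisFun K n).toMatrix b * X * b.toMatrix (Pi.basisFun K n) :=
      (continuous_const.matrix_mul continuous_id).matrix_mul continuous_const
    exact (hc.tendsto (Φ 0)).comp h1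
  -- the limit is invertible: `det` is continuous and constant along the sequence
  have hdet : (LinearMap.toMatrix' s).det = (g : Matrix n n K).det := by
    refine tendsto_nhds_unique ((continuous_id.matrix_det.tendsto _).comp hmat) ?_
    have : (fun m => ((D m * g * (D m)⁻¹ : GL n K) : Matrix n n K).det) = fun _ => (g : Matrix n n K).det := by
      funext m
      rw [Units.val_mul, Units.val_mul]
      exact Matrix.det_units_conj (D m) (g : Matrix n n K)
    change Tendsto (fun m => ((D m * g * (D m)⁻¹ : GL n K) : Matrix n n K).det) atTop _
    rw [this]
    exact tendsto_const_nhds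
  have hunit : IsUnit (LinearMap.toMatrix' s) := by
    rw [Matrix.isUnit_iff_isUnit_det, hdet]
    exact Matrix.isUnits_det_units g
  refine ⟨hunit.unit, hunit.unit_spec, by rw [hunit.unit_spec, Matrix.toLin'_toMatrix']; exact hss, ?_⟩
  rw [isEmbedding_GL_val.isInducing.tendsto_nhds_iff, Function.comp_def, hunit.unit_spec]
  exact hmat

/-- `toLin'` of an invertible matrix is injective. [folklore] -/
theorem toLin'_injective_of_GL (g : GL n K) : Function.Injective (Matrix.toLin' (g : Matrix n n K)) := by
  intro x y hxy
  have := congrArg (Matrix.toLin' ((g⁻¹ : GL n K) : Matrix n n K)) hxy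
  rwa [← Matrix.toLin'_mul_apply, ← Matrix.toLin'_mul_apply, ← Units.val_mul, inv_mul_cancel, Units.val_one,
    Matrix.toLin'_one, LinearMap.id_apply, LinearMap.id_apply] at this

/-- **`GL_n` over a topological field with a null sequence of units: the closure of every conjugacy class contains a semisimple
element.** [cite: HarishChandra1999, §21 p. 87] -/
theorem exists_mem_closure_conj_isSemisimple_of_seq [TopologicalSpace K] [IsTopologicalRing K] [ContinuousInv₀ K] [T2Space K]
    (t : ℕ → K) (ht0 : ∀ m, t m ≠ 0) (ht : Tendsto t atTop (𝓝 0)) (g : GL n K) :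
    ∃ s : GL n K, s ∈ closure (Set.range fun x : GL n K => x * g * x⁻¹) ∧
      Module.End.IsSemisimple (Matrix.toLin' (s : Matrix n n K)) := by
  classical
  obtain ⟨ι, _, b, e, s, h1, h2, h3, -⟩ := exists_flag_basis (Matrix.toLin' (g : Matrix n n K)) (toLin'_injective_of_GL g)
  choose D hD hD' using fun m => exists_GL_basis_zpow_smul b e (ht0 m)
  obtain ⟨S, -, hS, hT⟩ := tendsto_conj_of_flag_basis g b e s h1 h2 h3 t ht0 ht D hD hD'
  exact ⟨S, mem_closure_of_tendsto hT (Eventually.of_forall fun m => ⟨D m, rfl⟩), hS⟩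

end Limit

/-! ## §2 The model over a completion `E_w` -/

section Completion

open NumberField IsDedekindDomain

variable {E : Type} [Field E] [NumberField E] (w : HeightOneSpectrum (𝓞 E))

/-- A completion `E_w` carries a null sequence of non-zero elements (powers of a uniformiser; Mathlib `valuation_exists_uniformizer`,
`Valued.tendsto_zero_pow_of_le_exp_neg_one`). [folklore] -/
theorem exists_seq_ne_zero_tendsto_zero :
    ∃ t : ℕ → w.adicCompletion E, (∀ m, t m ≠ 0) ∧ Tendsto t atTop (𝓝 0) := by
  obtain ⟨π, hπ⟩ := IsDedekindDomain.HeightOneSpectrum.valuation_exists_uniformizer E w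
  have hv : Valued.v (π : w.adicCompletion E) = WithZero.exp (-1 : ℤ) := by
    rw [IsDedekindDomain.HeightOneSpectrum.valuedAdicCompletion_eq_valuation', hπ]
  have hne : (π : w.adicCompletion E) ≠ 0 := by
    intro h
    rw [h, map_zero] at hv
    exact WithZero.exp_ne_zero hv.symm
  exact ⟨fun m => (π : w.adicCompletion E) ^ m, fun m => pow_ne_zero _ hne,
    Valued.tendsto_zero_pow_of_le_exp_neg_one hv.le⟩

/-- **The `GL_N(E_w)` model of [HarishChandra1999, §21]: the closure of the conjugacy class of any `g ∈ GL_N(E_w)` contains a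
semisimple element** (used at the SPLIT places `U(H)(L⁺_v) ≅ GL_N(L_w)`). [cite: HarishChandra1999, §21 p. 87] -/
theorem exists_mem_closure_conj_isSemisimple_GL {n : Type*} [Fintype n] [DecidableEq n]
    (g : GL n (w.adicCompletion E)) :
    ∃ s : GL n (w.adicCompletion E), s ∈ closure (Set.range fun x : GL n (w.adicCompletion E) => x * g * x⁻¹) ∧
      Module.End.IsSemisimple (Matrix.toLin' (s : Matrix n n (w.adicCompletion E))) := by
  obtain ⟨t, ht0, ht⟩ := exists_seq_ne_zero_tendsto_zero w
  exact exists_mem_closure_conj_isSemisimple_of_seq t ht0 ht g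

end Completion

end Summit.HodgeConjecture.HodgeConjecture.Cruxes.H413.K2E3OrbitClosureFlagLimit
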